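import Mathlib
import Literature.MathematicalPhysics.QuantumFieldTheory.Balaban1983to89.B14Eq350Kernel
import Literature.MathematicalPhysics.QuantumFieldTheory.Balaban1983to89.B12CauchyRemainder354

/-!
# `Balaban1983to89.B14Eq349Remainder` — T. Bałaban, *Convergent renormalization expansions for lattice gauge theories*,
# Commun. Math. Phys. **119** (1988) 243–285 [Balaban1988Convergent]: the FIFTH-ORDER part of «the irrelevant terms» of
# (3.49) p. 280 — `𝐄^{(j)}(X, U_k, z) − 𝐄^{(j)}(X, 1, z) − Σ_{n=1}^{4} (1/n!)⟨𝐄^{(n)}(X, z), ⊗ⁿB⟩` bounded by Cauchy's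
# estimate along the ray, `≤ E₀ ρ⁻⁵ ‖B‖⁵ exp(−κd_j(X))`, hence `O((LʲL⁻ⁿ)^{5−β}) exp(−κd_j(X))` once `‖B‖ = O(LʲL⁻ⁿ)` —
# PROVED for the typed left-hand side `B14.Eq350Kernel.taylor4` from the tree's [I] (3.34)/(3.54) machinery

statement-level skeleton of published theorems with citation tags; proofs where landed; nothing here is a claim about the Yang–Mills mass gap

PDF held: `paper:balaban1988-cmp119-convergent-renormalization` (journal page = PDF page + 242); pp. 280–281 read on the
x2 renders `…-p038-x2.png`, `…-p039-x2.png` of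
`run/shared/lean/pub/pub-balaban/b2b-balaban-ref1/pages/1988-cmp119-convergent-renormalization/`.

CITATION HEADER (lean-in-tree rule).  WHAT IS REPRODUCED, verbatim, p. 280 [PDF 38]: *"𝐄^{(j)}(X, U_k, z) −
𝐄^{(j)}(X, 1, z) = Σ_{n=1}^{4} (1/n!) ⟨𝐄^{(n)}(X, z), ⊗ⁿ B⟩ + (the irrelevant terms) = … (3.49)"*, p. 281 [PDF 39]:
*"The irrelevant terms are bounded by O((LʲL⁻ⁿ)^{5−β}) exp(−κd_j(X))"*; the expansion is the one of [I] §3: *"Let us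
expand the above expressions up to the fifth order"* ((3.33)–(3.34), [Balaban1987RG1] p. 277) with the remainder bounded
by Cauchy's estimate (3.54) p. 280 of [I].  SKELETON row **B14.Eq3.49–3.50** (ROWS-B14 ≤ v1.17: «the
O((LʲL⁻ⁿ)^{5−β})e^{−κd_j(X)} bound … NOT typed»).

THE TYPED READING.  `F : (ι → 𝔤) → ℝ` is the function `B ↦ 𝐄^{(j)}(X, U_j(exp iB), z)` of `B14.Eq350Kernel` (its
`taylor4 F B = Σ_{n=1}^{4} (1/n!)⟨𝐄^{(n)}(X,z), ⊗ⁿB⟩`, `dTensor`).  The FIRST equality of (3.49) defines the irrelevant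
terms of fifth order in `B` as `F B − F 0 − taylor4 F B`; by [I] (3.34) this is the integral Taylor remainder
`∫₀¹ dτ ((1−τ)⁴/4!) ⟨D⁵F(τB), ⊗⁵B⟩` (`B12Taylor334.taylor334`), and by [I] (3.54) (Cauchy along the complex ray,
`B12CauchyRemainder354.taylor5_remainder_norm_le`) it is bounded by `M/r⁵` when the ray function `t ↦ F(tB)` extends,
near each `τ ∈ [0,1]`, to a holomorphic `Φ` with `‖Φ‖ ≤ M` on `ball τ r` — the analyticity (2.27)(ii) on
`Ũ_jᶜ(X, α_{0,j}, α_{1,j})` and the bound (2.27)(iv) `E₀exp(−κd_j(X))`, explicit hypotheses.  PROVED: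
`remainder349_norm_le` (`|F B − F 0 − taylor4 F B| ≤ M/r⁵`), the printed-constants form `remainder349_norm_le_printed`
(`r = ρ/‖B‖`, `M = E₀e^{−κd_j(X)}`: `≤ E₀ρ⁻⁵‖B‖⁵e^{−κd_j(X)}`) and the scale reading `remainder349_irrelevant`
(`‖B‖ ≤ a·σ`, `σ = LʲL⁻ⁿ ∈ (0,1]`, `β ≥ 0` ⇒ `≤ E₀ρ⁻⁵a⁵ · σ^{5−β} · e^{−κd_j(X)}`, i.e. «O((LʲL⁻ⁿ)^{5−β})exp(−κd_j(X))»
with `O(1) = E₀ρ⁻⁵a⁵`).  NOT HERE: the second equality of (3.49) (the Taylor expansion of `B` around `z` and the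
Ward–Takahashi manipulations of Sect. 4 [I] moving the factors to `z`), whose own irrelevant terms are the position-space
part of «the irrelevant terms» — row B14.Eq3.49–3.50 keeps that clause.

Mega-formalization `lit-balaban`, unit `lit-balaban-r11` gen 4 (B14 fold owner), HOME `run/shared/lean/pub/lit-balaban/`.

## References
* [Balaban1988Convergent] T. Bałaban, Commun. Math. Phys. 119 (1988) 243–285, (3.49) p. 280, p. 281 (the bound).
* [Balaban1987RG1] T. Bałaban, Commun. Math. Phys. 109 (1987) 249–301, (3.33)–(3.34) p. 277, (3.54) p. 280 ([I] of B14).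
-/

noncomputable section

open Set Filter Metric Finset
open scoped Topology Nat

namespace Literature.MathematicalPhysics.QuantumFieldTheory.Balaban1983to89.B14.Eq349Remainder

open Literature.MathematicalPhysics.QuantumFieldTheory.Balaban1983to89
open Literature.MathematicalPhysics.QuantumFieldTheory.Balaban1983to89.B14.Eq350Kernel

variable {ι : Type*} [Fintype ι] [DecidableEq ι] {𝔤 : Type*} [NormedAddCommGroup 𝔤] [NormedSpace ℝ 𝔤]

/-! ## §1. The fourth-order Taylor polynomial of (3.49) inside the [I] (3.34) expansion -/

omit [DecidableEq ι] in
/-- The complexified function `B ↦ (F B : ℂ)` has the complexified multilinear derivatives: at a point of `C⁵`-smoothness,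
`Dⁿ(ofReal ∘ F)(x)(v) = (DⁿF(x)(v) : ℂ)` for `n ≤ 5`. [cite: Balaban1988Convergent, (3.49) p.280] -/
theorem iteratedFDeriv_ofReal_comp {F : (ι → 𝔤) → ℝ} {x : ι → 𝔤} (hF : ContDiffAt ℝ 5 F x) {n : ℕ} (hn : n ≤ 5)
    (v : Fin n → (ι → 𝔤)) :
    iteratedFDeriv ℝ n (fun y => (F y : ℂ)) x v = ((iteratedFDeriv ℝ n F x v : ℝ) : ℂ) := by
  have h := Complex.ofRealCLM.iteratedFDeriv_comp_left (f := F) (x := x) hF (i := n) (by exact_mod_cast hn)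
  have hcomp : (fun y => (F y : ℂ)) = (Complex.ofRealCLM : ℝ →L[ℝ] ℂ) ∘ F := by
    funext y; simp
  rw [hcomp, h]
  simp

omit [DecidableEq ι] in
/-- The [I] (3.34) Taylor sum through order four, for the complexified `F`, is `F(0) + Σ_{n=1}^{4}(1/n!)⟨𝐄^{(n)},⊗ⁿB⟩`
(`B14.Eq350Kernel.taylor4`), as a complex number. [cite: Balaban1988Convergent, (3.49) p.280] -/
theorem sum_range_five_eq_taylor4 {F : (ι → 𝔤) → ℝ} (hF : ContDiffAt ℝ 5 F 0) (B : ι → 𝔤) :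
    ∑ n ∈ Finset.range 5, ((n ! : ℝ)⁻¹) • iteratedFDeriv ℝ n (fun y => (F y : ℂ)) 0 (fun _ => B)
      = ((F 0 + taylor4 F B : ℝ) : ℂ) := by
  have hterm : ∀ n ∈ Finset.range 5, ((n ! : ℝ)⁻¹) • iteratedFDeriv ℝ n (fun y => (F y : ℂ)) 0 (fun _ => B)
      = ((((n ! : ℕ) : ℝ)⁻¹ * dTensor F n B : ℝ) : ℂ) := by
    intro n hn
    have hn5 : n ≤ 5 := by
      have := Finset.mem_range.1 hn; omega
    rw [iteratedFDeriv_ofReal_comp hF hn5, dTensor, Complex.real_smul]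
    push_cast
    ring
  rw [Finset.sum_congr rfl hterm, ← Complex.ofReal_sum]
  congr 1
  rw [taylor4, show Finset.range 5 = insert 0 (Finset.Icc 1 4) by decide, Finset.sum_insert (by decide)]
  simp [dTensor, Nat.factorial]

/-! ## §2. The fifth-order irrelevant terms of (3.49), bounded -/

omit [DecidableEq ι] in
/-- **(3.49), fifth-order part of «the irrelevant terms», PROVED**: for `F = [B ↦ 𝐄^{(j)}(X, U_j(exp iB), z)]` of class
`C⁵` on an open set containing the segment `{τB : τ ∈ [0,1]}`, whose ray function extends near each `τ ∈ [0,1]` to a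
holomorphic `Φ` with `‖Φ‖ ≤ M` on `ball τ r` ((2.27)(ii),(iv)),
`|F(B) − F(0) − Σ_{n=1}^{4}(1/n!)⟨𝐄^{(n)}(X,z), ⊗ⁿB⟩| ≤ M / r⁵` ([I] (3.34) + (3.54)).
[cite: Balaban1988Convergent, (3.49) p.280] -/
theorem remainder349_norm_le {s : Set (ι → 𝔤)} (hs : IsOpen s) {F : (ι → 𝔤) → ℝ} (hF : ContDiffOn ℝ 5 F s)
    (B : ι → 𝔤) (hB : ∀ τ ∈ Icc (0 : ℝ) 1, τ • B ∈ s) {Φ : ℂ → ℂ} {r M : ℝ} (hr : 0 < r)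
    (hΦ : ∀ τ ∈ Icc (0 : ℝ) 1, DifferentiableOn ℂ Φ (ball (τ : ℂ) r))
    (hM : ∀ τ ∈ Icc (0 : ℝ) 1, ∀ w ∈ ball (τ : ℂ) r, ‖Φ w‖ ≤ M)
    (hagree : ∀ τ ∈ Icc (0 : ℝ) 1, ∀ᶠ t : ℝ in 𝓝 τ, ((F (t • B) : ℝ) : ℂ) = Φ (t : ℂ)) :
    |F B - F 0 - taylor4 F B| ≤ M / r ^ 5 := by
  have h0 : (0 : ι → 𝔤) ∈ s := by simpa using hB 0 (left_mem_Icc.2 zero_le_one)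
  have hF0 : ContDiffAt ℝ 5 F 0 := hF.contDiffAt (hs.mem_nhds h0)
  have hFc : ContDiffOn ℝ 5 (fun y => (F y : ℂ)) s := by
    have hcomp : (fun y => (F y : ℂ)) = (Complex.ofRealCLM : ℝ →L[ℝ] ℂ) ∘ F := by
      funext y; simp
    rw [hcomp]
    exact (Complex.ofRealCLM.contDiff.of_le le_top).comp_contDiffOn hF
  have h := B12CauchyRemainder354.taylor5_remainder_norm_le hs hFc B hB hr hΦ hM hagree
  rw [sum_range_five_eq_taylor4 hF0 B, ← Complex.ofReal_sub, Complex.norm_real, Real.norm_eq_abs] at h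
  have : F B - (F 0 + taylor4 F B) = F B - F 0 - taylor4 F B := by ring
  rw [this] at h
  exact h

omit [DecidableEq ι] in
/-- **The printed constants**: radius `r = ρ/‖B‖` (`B ≠ 0`; `ρ` the analyticity radius of (2.27)(ii) in the direction of
`B`) and `M = E₀exp(−κd_j(X))` ((2.27)(iv)):
`|F(B) − F(0) − Σ_{n=1}^{4}(1/n!)⟨𝐄^{(n)},⊗ⁿB⟩| ≤ E₀ ρ⁻⁵ ‖B‖⁵ exp(−κd_j(X))`. [cite: Balaban1988Convergent, (3.49) p.280] -/
theorem remainder349_norm_le_printed {s : Set (ι → 𝔤)} (hs : IsOpen s) {F : (ι → 𝔤) → ℝ} (hF : ContDiffOn ℝ 5 F s)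
    {B : ι → 𝔤} (hB0 : B ≠ 0) (hB : ∀ τ ∈ Icc (0 : ℝ) 1, τ • B ∈ s) {Φ : ℂ → ℂ} {ρ E₀ κ d : ℝ} (hρ : 0 < ρ)
    (hΦ : ∀ τ ∈ Icc (0 : ℝ) 1, DifferentiableOn ℂ Φ (ball (τ : ℂ) (ρ / ‖B‖)))
    (hM : ∀ τ ∈ Icc (0 : ℝ) 1, ∀ w ∈ ball (τ : ℂ) (ρ / ‖B‖), ‖Φ w‖ ≤ E₀ * Real.exp (-(κ * d)))
    (hagree : ∀ τ ∈ Icc (0 : ℝ) 1, ∀ᶠ t : ℝ in 𝓝 τ, ((F (t • B) : ℝ) : ℂ) = Φ (t : ℂ)) :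
    |F B - F 0 - taylor4 F B| ≤ E₀ * ρ⁻¹ ^ 5 * ‖B‖ ^ 5 * Real.exp (-(κ * d)) := by
  have hnB : 0 < ‖B‖ := norm_pos_iff.mpr hB0
  have h := remainder349_norm_le hs hF B hB (div_pos hρ hnB) hΦ hM hagree
  refine h.trans (le_of_eq ?_)
  field_simp

/-- Scale arithmetic behind «O((LʲL⁻ⁿ)^{5−β})»: for `0 < σ ≤ 1` and `β ≥ 0`, `σ⁵ ≤ σ^{5−β}`.
[cite: Balaban1988Convergent, p.281 (the bound after (3.50))] -/
theorem pow_five_le_rpow {σ β : ℝ} (hσ : 0 < σ) (hσ1 : σ ≤ 1) (hβ : 0 ≤ β) :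
    σ ^ 5 ≤ σ ^ (5 - β : ℝ) := by
  have h : σ ^ (5 : ℝ) ≤ σ ^ (5 - β : ℝ) :=
    Real.rpow_le_rpow_of_exponent_ge hσ hσ1 (by linarith)
  have h5 : σ ^ (5 : ℝ) = σ ^ 5 := by exact_mod_cast Real.rpow_natCast σ 5
  rwa [h5] at h

omit [DecidableEq ι] in
/-- **«The irrelevant terms are bounded by O((LʲL⁻ⁿ)^{5−β}) exp(−κd_j(X))»** (p. 281), fifth-order part: if the field
on the relevant cube is of the size of the scale factor, `‖B‖ ≤ a·σ` with `σ = LʲL⁻ⁿ ∈ (0, 1]`, then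
`|F(B) − F(0) − Σ_{n=1}^{4}(1/n!)⟨𝐄^{(n)},⊗ⁿB⟩| ≤ (E₀ρ⁻⁵a⁵) · σ^{5−β} · exp(−κd_j(X))` for every `β ≥ 0`
(the printed `β` of (2.42)). [cite: Balaban1988Convergent, (3.49) p.280, p.281] -/
theorem remainder349_irrelevant {s : Set (ι → 𝔤)} (hs : IsOpen s) {F : (ι → 𝔤) → ℝ} (hF : ContDiffOn ℝ 5 F s)
    {B : ι → 𝔤} (hB0 : B ≠ 0) (hB : ∀ τ ∈ Icc (0 : ℝ) 1, τ • B ∈ s) {Φ : ℂ → ℂ} {ρ E₀ κ d a σ β : ℝ} (hρ : 0 < ρ)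
    (hE₀ : 0 ≤ E₀) (ha : 0 ≤ a) (hσ : 0 < σ) (hσ1 : σ ≤ 1) (hβ : 0 ≤ β) (hBσ : ‖B‖ ≤ a * σ)
    (hΦ : ∀ τ ∈ Icc (0 : ℝ) 1, DifferentiableOn ℂ Φ (ball (τ : ℂ) (ρ / ‖B‖)))
    (hM : ∀ τ ∈ Icc (0 : ℝ) 1, ∀ w ∈ ball (τ : ℂ) (ρ / ‖B‖), ‖Φ w‖ ≤ E₀ * Real.exp (-(κ * d)))
    (hagree : ∀ τ ∈ Icc (0 : ℝ) 1, ∀ᶠ t : ℝ in 𝓝 τ, ((F (t • B) : ℝ) : ℂ) = Φ (t : ℂ)) :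
    |F B - F 0 - taylor4 F B| ≤ E₀ * ρ⁻¹ ^ 5 * a ^ 5 * σ ^ (5 - β : ℝ) * Real.exp (-(κ * d)) := by
  have h := remainder349_norm_le_printed hs hF hB0 hB hρ hΦ hM hagree
  have h1 : ‖B‖ ^ 5 ≤ (a * σ) ^ 5 := pow_le_pow_left₀ (norm_nonneg _) hBσ 5
  have h2 : (a * σ) ^ 5 = a ^ 5 * σ ^ 5 := by ring
  have h3 : σ ^ 5 ≤ σ ^ (5 - β : ℝ) := pow_five_le_rpow hσ hσ1 hβ
  have hc : 0 ≤ E₀ * ρ⁻¹ ^ 5 := by positivity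
  have he : 0 ≤ Real.exp (-(κ * d)) := (Real.exp_pos _).le
  calc |F B - F 0 - taylor4 F B| ≤ E₀ * ρ⁻¹ ^ 5 * ‖B‖ ^ 5 * Real.exp (-(κ * d)) := h
    _ ≤ E₀ * ρ⁻¹ ^ 5 * (a ^ 5 * σ ^ (5 - β : ℝ)) * Real.exp (-(κ * d)) := by
        apply mul_le_mul_of_nonneg_right _ he
        apply mul_le_mul_of_nonneg_left _ hc
        calc ‖B‖ ^ 5 ≤ a ^ 5 * σ ^ 5 := h2 ▸ h1
          _ ≤ a ^ 5 * σ ^ (5 - β : ℝ) := mul_le_mul_of_nonneg_left h3 (by positivity)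
    _ = E₀ * ρ⁻¹ ^ 5 * a ^ 5 * σ ^ (5 - β : ℝ) * Real.exp (-(κ * d)) := by ring

end Literature.MathematicalPhysics.QuantumFieldTheory.Balaban1983to89.B14.Eq349Remainder
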